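import Literature.AlgebraicGeometry.Frobenioids.PadicFrobenioidZeroMonoid
import Literature.AlgebraicGeometry.Frobenioids.PadicFrobenioidUnitGroups
import Literature.AlgebraicGeometry.Frobenioids.PadicFrobenioidThm12TypesProofs
import Literature.AlgebraicGeometry.Frobenioids.ModelFrobenioidStandard
import HarnessLib

/-!
# Frobenioids II, Example 1.1 (ii) / Theorem 1.2 (i): `Φ`, `B` are monoids on `D`; `Φ` is non-dilating

Mochizuki, *The geometry of Frobenioids II*, Kyushu J. Math. **62** (2008) 401–460, §1, Example 1.1
(ii) p. 8 ("the Frobenioid `C` that arises as the model Frobenioid associated to this data `Φ`,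
`B → Φ^gp` [cf. [FrdI], Theorem 5.2, (ii)]") and Theorem 1.2 (i), third sentence, p. 9 ("If `D` is of
FSMFF-type, then `C` is of rationally standard type") with its proof p. 9 ("for `A_D ∈ Ob(D)`, the
monoid `End_D(A_D)` acts trivially on `Φ(A_D)`") [cite: MochizukiFrdII2008, Ex 1.1 (ii) p.8]
[cite: MochizukiFrdII2008, Thm 1.2 (i) p.9].

PROOF-ONLY file (seat abc-iut-L1-d10; nodes `FrdII:Ex1.1(ii)`, `FrdII:Thm1.2(i)` third sentence —
the inputs of [FrdI] Thm. 5.2 (ii)/(iii) for a `p`-adic Frobenioid datum `d : PadicFrd.Datum D p`):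
* the pull-back maps of `Φ` and of `B` are (characteristically) INJECTIVE for every datum
  (`map_Φ_injective`, `isCharInjective_Φ`, `map_B_injective`, `isCharInjective_B`): `Φ ⊆ Φ₀|_D` is a
  subfunctor of `Spec K ↦ ord(O_K^⊳) ⊗ ℝ_{≥0}` whose restriction maps along the (valuative, finite)
  field extensions `K_A → K_B` are injective (abc-iut-L1-d8's `ordIntMapOfHom_injective`,
  `Realification.map_injective_of_isZMonoprime`), and `B(A) = K_A^× ×_{Φ₀^gp(A)} Φ^gp(A)`;
* hence the standing hypothesis `d.IsMonoidData` of abc-iut-L1-t4's `PadicFrobenioidThm12.lean`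
  ("`Φ`, `B` are monoids on `D`", [FrdI] Def. 1.1 (ii)) HOLDS for EVERY datum over a base `D` of
  FSM-type (`isMonoidData_of_isOfFSMType`; generalises abc-iut-L1-d8's `Datum.zero_isMonoidData`),
  e.g. `D = B^temp(Π, Π°)⁰` of Ex. 1.3 (i) or `D = D₀`;
* `Φ` is NON-DILATING, unconditionally (`isNonDilatingOn`, clause (c) of [FrdI] Thm. 5.2 (iii)):
  the endomorphisms of `Φ(A_D)` induced by `End_D(A_D)` are identities (`Datum.endTrivial`,
  `PadicFrobenioidThm12TypesProofs.lean`: valuative endomorphisms of a finite extension of `ℚ_p`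
  preserve the valuation);
* `Φ` is not the zero monoid (`not_isZeroMonoid`; clause (a) of Thm. 5.2 (iii) is vacuous).
The standard-type conclusion itself ([FrdI] Thm. 5.2 (iii) applied to these inputs) is filed
separately once abc-iut-L1-t2's `ModelFrobenioid.standardTypeIff_holds` lands. No definitions;
nothing here bears on [IUTchIII].
-/

namespace Literature.AlgebraicGeometry.Frobenioids

open CategoryTheory Opposite Function

universe v u

namespace PadicFrd

/-- The underlying map of an isomorphism of `CommMonCat` is bijective. [cite: MochizukiFrdI2008, Def. 1.1 (ii) p.19] -/
private theorem bijective_hom_of_isIso_d10 {X Y : CommMonCat.{u}} (f : X ⟶ Y) [IsIso f] :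
    Bijective f.hom := by
  refine Function.bijective_iff_has_inverse.mpr ⟨(inv f).hom, fun x => ?_, fun y => ?_⟩
  · change (f ≫ inv f).hom x = x
    rw [IsIso.hom_inv_id]
    rfl
  · change (inv f ≫ f).hom y = y
    rw [IsIso.inv_hom_id]
    rfl

namespace Datum

variable {D : Type u} [Category.{v} D] {p : ℕ} [Fact p.Prime] (d : Datum D p)

/-! ### Pull-backs of `Φ₀|_D`, `Φ` and `B` are injective -/

/-- The restriction map `Φ₀(A) → Φ₀(B)` of `Φ₀|_D = Spec K ↦ ord(O_K^⊳) ⊗ ℝ_{≥0}` along any arrow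
`g : B → A` of `D` is injective (`K_A → K_B` is a valuative homomorphism of finite extensions of `ℚ_p`).
[cite: MochizukiFrdII2008, Ex 1.1 (i) p.7] -/
theorem map_phiZeroOn_injective {A B : D} (g : B ⟶ A) :
    Injective ((phiZeroOn d.base).map g.op).hom := by
  obtain ⟨instA, hfinA, hcA⟩ := (d.isPadicLocal A).exists_finite
  obtain ⟨instB, hfinB, hcB⟩ := (d.isPadicLocal B).exists_finite
  have hA : IsZMonoprime (OrdInt (d.base.obj A).K) := by
    letI := instA; haveI := hfinA; exact PadicFld.isZMonoprime_ordInt (d.base.obj A) hcA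
  have hB : IsZMonoprime (OrdInt (d.base.obj B).K) := by
    letI := instB; haveI := hfinB; exact PadicFld.isZMonoprime_ordInt (d.base.obj B) hcB
  change Injective (Realification.map (ordIntMapOfHom (d.base.map g).alg (d.base.map g).isValHom))
  exact Realification.map_injective_of_isZMonoprime hA hB _ (ordIntMapOfHom_injective _ _)

/-- The pull-back `Φ(g) : Φ(A) → Φ(B)` of the subfunctor `Φ ⊆ Φ₀|_D` along any arrow `g : B → A` of
`D` is injective. [cite: MochizukiFrdII2008, Ex 1.1 (ii) p.8] -/
theorem map_Φ_injective {A B : D} (g : B ⟶ A) : Injective (d.Φ.map g.op).hom := by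
  intro x y hxy
  apply d.ι_injective (op A)
  apply d.map_phiZeroOn_injective g
  have n := fun z => congrArg (fun φ => φ.hom z) (d.ι.naturality g.op)
  simp only [CommMonCat.hom_comp, MonoidHom.comp_apply] at n
  rw [← n x, ← n y]
  exact congrArg _ hxy

/-- `Φ(g)` is characteristically injective ([FrdI] Def. 1.1 (ii)(a) for `Φ`): injective into the
sharp (monoprime) monoid `Φ(B)`. [cite: MochizukiFrdII2008, Ex 1.1 (ii) p.8] -/
theorem isCharInjective_Φ {A B : D} (g : B ⟶ A) : IsCharInjective (pull d.Φ g) :=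
  isCharInjective_of_injective_of_isSharp _ (d.map_Φ_injective g) (d.isMonoprime (op B)).isSharp

/-- The groupified pull-back `Φ^gp(g) : Φ^gp(A) → Φ^gp(B)` is injective (`Φ(B)` is cancellative).
[cite: MochizukiFrdII2008, Ex 1.1 (ii) p.8] -/
theorem map_monoidGp_Φ_injective {A B : D} (g : B ⟶ A) :
    Injective ((monoidGp d.Φ).map g.op).hom := by
  haveI : IsCancelMul (d.Φ.obj (op B)) := (d.isMonoprime (op B)).isCancelMul
  change Injective (MonGp.map (d.Φ.map g.op).hom)
  exact MonGp.map_injective _ (d.map_Φ_injective g)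

/-- The pull-back `B(g) : B(A) → B(B)` of `B = B₀|_D ×_{Φ₀^gp|_D} Φ^gp` along any arrow `g : B → A` of
`D` is injective: both components `K_A^× → K_B^×` (a field homomorphism) and `Φ^gp(g)` are.
[cite: MochizukiFrdII2008, Ex 1.1 (ii) p.8] -/
theorem map_B_injective {A B : D} (g : B ⟶ A) : Injective (d.B.map g.op).hom := by
  intro u u' h
  apply d.B_ext (op A)
  · have n := fun z => congrArg (fun φ => φ.hom z) (d.toB0.naturality g.op)
    simp only [CommMonCat.hom_comp, MonoidHom.comp_apply] at n
    have hinj : Injective ((bZeroOn d.base).map g.op).hom := by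
      change Injective (Units.map ((d.base.map g).alg : (d.base.obj A).K →* (d.base.obj B).K))
      exact Units.map_injective (d.base.map g).alg.injective
    apply hinj
    rw [← n u, ← n u']
    exact congrArg _ h
  · have n := fun z => congrArg (fun φ => φ.hom z) (d.divB.naturality g.op)
    simp only [CommMonCat.hom_comp, MonoidHom.comp_apply] at n
    apply d.map_monoidGp_Φ_injective g
    change ((monoidGp d.Φ).map g.op).hom ((d.divB.app (op A)).hom u) =
      ((monoidGp d.Φ).map g.op).hom ((d.divB.app (op A)).hom u')
    rw [← n u, ← n u']
    exact congrArg _ h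

/-- `B(g)` is characteristically injective ([FrdI] Def. 1.1 (ii)(a) for `B`): injective, and
`B(A)^char` is trivial since `B(A)` is a group (`Datum.isUnit_B`). [cite: MochizukiFrdII2008, Ex 1.1 (ii) p.8] -/
theorem isCharInjective_B {A B : D} (g : B ⟶ A) : IsCharInjective (pull d.B g) := by
  refine ⟨d.map_B_injective g, ?_⟩
  haveI : Subsingleton (Associates (d.B.obj (op A))) := ⟨fun x y => by
    obtain ⟨a, rfl⟩ := Associates.mk_surjective x
    obtain ⟨b, rfl⟩ := Associates.mk_surjective y
    obtain ⟨ua, hua⟩ := d.isUnit_B (op A) a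
    obtain ⟨ub, hub⟩ := d.isUnit_B (op A) b
    exact Associates.mk_eq_mk_iff_associated.mpr ⟨ua⁻¹ * ub, by
      rw [← hua, Units.val_mul, ← mul_assoc, Units.mul_inv, one_mul, hub]⟩⟩
  exact injective_of_subsingleton _

/-! ### `Φ`, `B` are monoids on a base of FSM-type -/

/-- Over a base `D` of FSM-type, `Φ` is a monoid on `D` ([FrdI] Def. 1.1 (ii)): pull-backs are
characteristically injective, and FSM-morphisms — isomorphisms — pull back to isomorphisms.
[cite: MochizukiFrdII2008, Ex 1.1 (ii) p.8] -/
theorem isMonoidOn_Φ_of_isOfFSMType (hD : IsOfFSMType D) : IsMonoidOn d.Φ := by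
  refine ⟨fun {A B} g => d.isCharInjective_Φ g, fun {A B} g hg => ?_⟩
  haveI : IsIso g := hD.isIso_of_isFSM g hg
  haveI : IsIso (d.Φ.map g.op) := inferInstance
  change Bijective (d.Φ.map g.op).hom
  exact bijective_hom_of_isIso_d10 (d.Φ.map g.op)

/-- Over a base `D` of FSM-type, `B` is a monoid on `D` ([FrdI] Def. 1.1 (ii)).
[cite: MochizukiFrdII2008, Ex 1.1 (ii) p.8] -/
theorem isMonoidOn_B_of_isOfFSMType (hD : IsOfFSMType D) : IsMonoidOn d.B := by
  refine ⟨fun {A B} g => d.isCharInjective_B g, fun {A B} g hg => ?_⟩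
  haveI : IsIso g := hD.isIso_of_isFSM g hg
  haveI : IsIso (d.B.map g.op) := inferInstance
  change Bijective (d.B.map g.op).hom
  exact bijective_hom_of_isIso_d10 (d.B.map g.op)

/-- **Example 1.1 (ii)**: the standing hypothesis `d.IsMonoidData` ("`Φ`, `B` are monoids on `D`",
the requirement of [FrdI] Thm. 5.2 behind "the Frobenioid `C` that arises as the model Frobenioid
associated to this data") HOLDS for every `p`-adic Frobenioid datum over a base `D` of FSM-type.
[cite: MochizukiFrdII2008, Ex 1.1 (ii) p.8] -/
theorem isMonoidData_of_isOfFSMType (hD : IsOfFSMType D) : d.IsMonoidData :=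
  ⟨d.isMonoidOn_Φ_of_isOfFSMType hD, d.isMonoidOn_B_of_isOfFSMType hD⟩

/-- For an arbitrary base, `d.IsMonoidData` reduces to its clause (b) for `Φ` and `B`
(FSM-morphisms of `D` pull back to bijections): clause (a) always holds.
[cite: MochizukiFrdII2008, Ex 1.1 (ii) p.8] -/
theorem isMonoidData_of_bijective
    (hΦ : ∀ {A B : D} (g : B ⟶ A), IsFSM g → Bijective (pull d.Φ g))
    (hB : ∀ {A B : D} (g : B ⟶ A), IsFSM g → Bijective (pull d.B g)) : d.IsMonoidData :=
  ⟨⟨fun g => d.isCharInjective_Φ g, fun g hg => hΦ g hg⟩,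
    ⟨fun g => d.isCharInjective_B g, fun g hg => hB g hg⟩⟩

/-! ### `Φ` is non-dilating and nonzero (clauses (c), (a) of [FrdI] Thm. 5.2 (iii)) -/

/-- **Thm. 1.2 (i)** (input (c) of [FrdI] Thm. 5.2 (iii)): `Φ` is NON-DILATING — for every
`α ∈ End_D(A_D)` the induced endomorphism of `Φ(A_D)` is the identity ("the monoid `End_D(A_D)` acts
trivially on `Φ(A_D)`", FrdII p. 9, `Datum.endTrivial`), so its characteristic is the identity.
[cite: MochizukiFrdII2008, Thm 1.2 (i) p.9] -/
theorem isNonDilatingOn : IsNonDilatingOn d.Φ := fun A α _ => by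
  have h : d.Φ.map α.op = 𝟙 _ := d.endTrivial α
  change associatesMap (d.Φ.map α.op).hom = MonoidHom.id _
  rw [h]
  ext x
  obtain ⟨a, rfl⟩ := Associates.mk_surjective x
  rw [associatesMap_mk]
  rfl

/-- **Thm. 1.2 (i)** (input (a) of [FrdI] Thm. 5.2 (iii) is vacuous): `Φ` is NOT the zero monoid —
`D` is connected, hence nonempty, and `Φ(A) ≠ 0` for every `A` ("the homomorphism `B(A) → Φ^gp(A)` is
nonzero"). [cite: MochizukiFrdII2008, Ex 1.1 (ii) p.8] -/
theorem not_isZeroMonoid : ¬ ModelFrobenioid.IsZeroMonoid d.Φ := fun h => by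
  obtain ⟨A⟩ := d.isConnected_base.is_nonempty
  obtain ⟨x, hx⟩ := d.exists_ne_one (op A)
  exact hx (h _ x)

end Datum

end PadicFrd

end Literature.AlgebraicGeometry.Frobenioids
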